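import Literature.NumberTheory.GaloisCohomology.Howard2004.DualityDatumIsotropy
import Literature.NumberTheory.EllipticCurves.ZpExtensionEisensteinTwistDualityDatum
import Literature.NumberTheory.EllipticCurves.ZpExtensionEisensteinSelmerStructure
import Literature.NumberTheory.EllipticCurves.ConjugatePairingDuality
import HarnessLib

/-!
# Howard's Lemma 3.1.1 at finite level: the twisted plus parts `A_{m,k} ⊗ Fil_v` are `e_𝔮`-orthogonal, hence the
# strict ORDINARY cores of `F_𝔮` at `v ∣ p` and at `v̄` are orthogonal under the induced local pairing
# (theorems only; no definition, no named fact, no instance, no `sorry`)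

Topic `NumberTheory/EllipticCurves` (cell `pub/bsd-print-x9`, D1 road; H.4 at `v ∣ p` for the saturated ordinary Selmer
structure `F_𝔮` of `ZpExtensionEisensteinSelmerStructure`, memo `HOME/p1/H4-AT-P-PLAN` steps (E2) + (A1)).

Howard [Howard 2004, Lemma 2.1.1 / Lemma 3.1.1 (arXiv:1202.6340 Lemma 3.1.1, p. 15 L60–62)]: «The submodule
`Fil_v(T_𝔭) ⊂ T_𝔭` is its own exact orthogonal complement under the pairing `e_𝔭`» — because `Fil_v T` is (the
Weil pairing `e` is alternating and `Fil_v T = Fil_v T_p(E)` has rank one) and `e_𝔭(t₁ ⊗ α₁, t₂ ⊗ α₂) =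
e(t₁, t₂^τ) α₁ α₂`; and Def. 3.2.6 remark (p. 16 L108–110): «the local conditions … are everywhere exact orthogonal
complements under the local Tate pairing». This file proves the ISOTROPY half at one finite level `k`, for the
tree's objects:

* §1 **`ZpExtension.eisensteinDualityDatum_e_span_tmul_eq_zero`** — for x9-p1-w4's datum
  `D = eisensteinDualityDatum hm k cd κ ρ ẽ …` on `W_k = M ⊗ A_{m,k}(ψ)` and two subgroups `Fil, Fil' ≤ M` with the
  `E`-LEVEL orthogonality `ẽ(a, δ_v a') = 0` (`a ∈ Fil`, `a' ∈ Fil'`; `δ_v` the inner correction of the conjugation datum),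
  the spans `A_{m,k} ⊗ Fil`, `A_{m,k} ⊗ Fil'` are `e`-orthogonal after `δ_v`:
  `D.e s (W_k(δ_v) t) = 0` — pure tensors: `W_k(δ_v)(d ⊗ a') = (u d) ⊗ ρ(δ_v) a'` (`eisensteinTwist_apply_tmul`) and
  `e(c ⊗ a, d' ⊗ b) = c d' ι(ẽ(a, b))` (`eisensteinDualityDatum_e_tmul_tmul`).
* §2 `ZpExtension.localCup_ordinaryCore_eq_zero_of_orthogonal` (ANY level-`k` datum `D` killing
  `(A ⊗ Fil_v) × δ_v(A ⊗ Fil_v̄)`) and **`ZpExtension.localCup_ordinaryCore_eq_zero`** — for a tower `(ρ k, t k)` with ordinary data `Φ_v`, `Φ_v̄`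
  (`ZpExtension.OrdinaryFiltration`, `v̄ = σ • v`) whose plus parts satisfy the `E`-level clause at level `k`, the strict
  ordinary cores `Φ_v.ordinaryCore hm k = ker (H¹(K_v, W_k) → H¹(K_v, W_k / A ⊗ Fil_v))` and the transport
  `transportH1` of `Φ_v̄.ordinaryCore hm k` are orthogonal under `D.localCup (inr v)` (generic isotropy
  `DualityDatum.localCup_eq_zero_of_mem_strictSubgroup` of `Howard2004/DualityDatumIsotropy`) — the (Iso) input at `v ∣ p`
  of the two «`→`» clauses of `DualityDatum.IsSelfOrthogonalAt` / of x10b-p1-w8's saturated-annihilator descent.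
* §3 the `E`-level clause for Howard's form `ẽ = conjPairing e θ log` (`(a, b) ↦ log e(a, θ b)`, Rem. 1.3.2):
  **`conjPairing_eq_zero_of_isotropic`** — it holds as soon as `θ ∘ ρ(δ_v)` carries `Fil'` into `Fil` (PLACE
  COMPATIBILITY of the conjugation: for `ConjugationDatum.ofLifts` and `θ` = the action of `τ`, `θ ∘ δ_v = τ_v` is the
  lift ADAPTED to `K̄_v̄ ≃ K̄_v`; supplied by the instantiator) and `e(Fil, Fil) = 0`; and
  **`pairing_eq_zero_of_cyclic`** — an `e` with `e(a, a) = 0` vanishes on any CYCLIC subgroup (`Fil_v E[p^k] = Ê[p^k]` is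
  cyclic at a good ordinary `v ∣ p`: Greenberg LNM 1716 §2, tree `exists_generator_torsionBy_ker_goodReductionHom`).

Nothing is asserted about any curve; the `E`-instance (`M = E[p^k]`, `Fil = torsionFilAt`, `e` = Weil pairing) is for the
consumer. BSD is not proved by any of this.

References: [Howard2004HeegnerKolyvagin] B. Howard, Compositio Math. 140 (2004), Lemma 2.1.1, §1.3 H.4 and Rem. 1.3.2,
Lemma 3.1.1, Def. 3.2.6 (arXiv:1202.6340 p. 7 L69–90, p. 15 L56–62, p. 16 L108–110); [GreenbergLNM1716] §2 (pp. 62, 82–83);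
[SilvermanAEC2009] III.8.1 (Weil pairing alternating).
-/

noncomputable section

open scoped TensorProduct ContRepresentation
open Field NumberField IsDedekindDomain

namespace Literature.NumberTheory.EllipticCurves

open Literature.NumberTheory.GaloisRepresentations Literature.NumberTheory.GaloisCohomology.Howard2004
open IwasawaAlgebra

namespace ZpExtension

variable {K : Type} [Field K] [NumberField K] {p : ℕ} [hp : Fact p.Prime] {m : ℕ} (hm : 1 ≤ m) (k : ℕ)
  (cd : ConjugationDatum K) (κ : ZpExtension K p)
  {M : Type} [AddCommGroup M] [TopologicalSpace M] [DiscreteTopology M] (ρ : DiscreteGaloisModule K M)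
  (eb : M →+ M →+ ZMod (p ^ k))
  (hsymm : ∀ a b : M, eb a b = eb b a)
  (hequiv : ∀ (g : absoluteGaloisGroup K) (a b : M),
    eb (ρ g a) (ρ (cd.conj g) b) = cyclotomicCharacterModPow K p k g * eb a b)
  (hnd : ∀ w : M, (∀ b : M, eb w b = 0) → w = 0) (hex : ∀ φ : M →+ ZMod (p ^ k), ∃ w : M, ∀ b : M, eb w b = φ b)
  (hκ : ∀ g : absoluteGaloisGroup K,
    p ^ eisensteinLevel (p := p) hm k ∣ κ.twistExponent (eisensteinLevel (p := p) hm k) g +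
      κ.twistExponent (eisensteinLevel (p := p) hm k) (cd.conj g))

/-! ## §1 `A_{m,k} ⊗ Fil_v` and `δ_v · (A_{m,k} ⊗ Fil_v̄)` are `e_𝔮`-orthogonal -/

/-- **Howard's Lemma 3.1.1, isotropy half, at level `k`.** If `ẽ(a, δ_v a') = 0` for `a ∈ Fil`, `a' ∈ Fil'`, then
for `s ∈ A_{m,k} ⊗ Fil` and `t ∈ A_{m,k} ⊗ Fil'` (the `ℤ`-spans of the pure tensors) `e_𝔮(s, δ_v · t) = 0` for the
datum `eisensteinDualityDatum` (`δ_v` acting through the twisted action of `W_k`).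
[cite: Howard2004HeegnerKolyvagin, Lemma 2.1.1 and Lemma 3.1.1 (arXiv p. 15, L60–62)] -/
theorem eisensteinDualityDatum_e_span_tmul_eq_zero (v : HeightOneSpectrum (𝓞 K)) (Fil Fil' : AddSubgroup M)
    (horth : ∀ a ∈ Fil, ∀ a' ∈ Fil', eb a (ρ (cd.δ v) a') = 0)
    {s : EisensteinCoeff.Twisted p m k M}
    (hs : s ∈ Submodule.span ℤ {x | ∃ (c : EisensteinCoeff p m k) (a : M), a ∈ Fil ∧ x = EisensteinCoeff.Twisted.tmul c a})
    {t : EisensteinCoeff.Twisted p m k M}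
    (ht : t ∈ Submodule.span ℤ {x | ∃ (c : EisensteinCoeff p m k) (a : M), a ∈ Fil' ∧ x = EisensteinCoeff.Twisted.tmul c a}) :
    (eisensteinDualityDatum hm k cd κ ρ eb hsymm hequiv hnd hex hκ).e s (κ.eisensteinTwist ρ hm k (cd.δ v) t) = 0 := by
  set D := eisensteinDualityDatum hm k cd κ ρ eb hsymm hequiv hnd hex hκ with hD
  -- first: every `s` in the span pairs to zero with `δ_v · (d ⊗ a')`, `a' ∈ Fil'`
  have hgen : ∀ (d : EisensteinCoeff p m k) (a' : M), a' ∈ Fil' →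
      D.e s (κ.eisensteinTwist ρ hm k (cd.δ v) (EisensteinCoeff.Twisted.tmul d a')) = 0 := by
    intro d a' ha'
    rw [eisensteinTwist_apply_tmul]
    induction hs using Submodule.span_induction with
    | mem x hx =>
      obtain ⟨c, a, ha, rfl⟩ := hx
      rw [hD, eisensteinDualityDatum_e_tmul_tmul, horth a ha a' ha', map_zero, mul_zero]
    | zero => rw [map_zero, LinearMap.zero_apply]
    | add x y _ _ hx hy => rw [map_add, LinearMap.add_apply, hx, hy, add_zero]
    | smul n x _ hx =>
      rw [← LinearMap.flip_apply D.e, map_zsmul, LinearMap.flip_apply, hx, zsmul_zero]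
  induction ht using Submodule.span_induction with
  | mem x hx =>
    obtain ⟨d, a', ha', rfl⟩ := hx
    exact hgen d a' ha'
  | zero => rw [map_zero, map_zero]
  | add x y _ _ hx hy => rw [map_add, map_add, hx, hy, add_zero]
  | smul n x _ hx => rw [map_zsmul, map_zsmul, hx, zsmul_zero]

/-! ## §2 The strict ordinary cores at `v` and `v̄` are `localCup`-orthogonal -/

section Cores

variable {N : ℕ → Type} [∀ j, AddCommGroup (N j)] [∀ j, TopologicalSpace (N j)] [∀ j, DiscreteTopology (N j)]
  (τ : ∀ j, DiscreteGaloisModule K (N j))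
  (t : ∀ j, (τ (j + 1)).toContRepresentation →ⁱL (τ j).toContRepresentation)
  (ebk : N k →+ N k →+ ZMod (p ^ k))
  (hsymmk : ∀ a b : N k, ebk a b = ebk b a)
  (hequivk : ∀ (g : absoluteGaloisGroup K) (a b : N k),
    ebk (τ k g a) (τ k (cd.conj g) b) = cyclotomicCharacterModPow K p k g * ebk a b)
  (hndk : ∀ w : N k, (∀ b : N k, ebk w b = 0) → w = 0)
  (hexk : ∀ φ : N k →+ ZMod (p ^ k), ∃ w : N k, ∀ b : N k, ebk w b = φ b)

/-- **The strict ordinary cores are isotropic, for ANY level-`k` duality datum `D` whose pairing kills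
`(A ⊗ Fil_v) × δ_v · (A ⊗ Fil_v̄)`** (the form in which a `DVRSetting` carrying `D` as a parameter consumes it): every class
of `Φ_v.ordinaryCore hm k = ker (H¹(K_v, W_k) → H¹(K_v, W_k / A ⊗ Fil_v))` is `D.localCup`-orthogonal to the transport of
every class of `Φ_v̄.ordinaryCore hm k` (generic `DualityDatum.localCup_eq_zero_of_mem_strictSubgroup`, with
`V = Φ_v.twistedFil k`, `V' = Φ_v̄.twistedFil k`, stable by `twistedFil_le_comap`).
[cite: Howard2004HeegnerKolyvagin, H.4, Lemma 3.1.1 and Def. 3.2.6 (arXiv p. 7 L78–82, p. 15 L60–62, p. 16 L108–110)] -/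
theorem localCup_ordinaryCore_eq_zero_of_orthogonal (v : HeightOneSpectrum (𝓞 K)) (Φ : OrdinaryFiltration τ t v)
    (Φ' : OrdinaryFiltration τ t (cd.σ • v))
    (D : DualityDatum p cd (κ.eisensteinTwist (τ k) hm k) (EisensteinCoeff p m k))
    (horthW : ∀ s ∈ Φ.twistedFil k, ∀ s' ∈ Φ'.twistedFil k, D.e s (κ.eisensteinTwist (τ k) hm k (cd.δ v) s') = 0)
    {x : galoisCohomology ((κ.eisensteinTwist (τ k) hm k).toLocal (Sum.inr v)) 1}
    (hx : x ∈ Φ.ordinaryCore hm k)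
    {y : galoisCohomology ((cd.twist (κ.eisensteinTwist (τ k) hm k)).toLocal (Sum.inr v)) 1}
    (hy : y ∈ (Φ'.ordinaryCore hm k).map (cd.transportH1 (κ.eisensteinTwist (τ k) hm k) v)) :
    D.localCup (Sum.inr v) x y = 0 :=
  D.localCup_eq_zero_of_mem_strictSubgroup v (Φ.twistedFil k) (Φ'.twistedFil k) (Φ.twistedFil_le_comap hm k)
    (Φ'.twistedFil_le_comap hm k) horthW hx hy

/-- **The strict ordinary cores are isotropic** (H.4 at `v ∣ p`, isotropy half, memo H4-AT-P-PLAN (E2)+(A1)): for ordinary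
data `Φ_v`, `Φ_v̄` of the tower `(τ j, t j)` at `v` and `v̄ = σ • v` whose plus parts at level `k` satisfy the `E`-level
clause `ẽ(a, δ_v a') = 0` (`a ∈ Fil_v`, `a' ∈ Fil_v̄`), every class of the strict core
`Φ_v.ordinaryCore hm k = ker (H¹(K_v, W_k) → H¹(K_v, W_k / A ⊗ Fil_v))` is orthogonal, under the induced local pairing
of x9-p1-w4's level-`k` duality datum `eisensteinDualityDatum … ẽ …`, to the transport of every class of
`Φ_v̄.ordinaryCore hm k`.
[cite: Howard2004HeegnerKolyvagin, H.4, Lemma 3.1.1 and Def. 3.2.6 (arXiv p. 7 L78–82, p. 15 L60–62, p. 16 L108–110)] -/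
theorem localCup_ordinaryCore_eq_zero (v : HeightOneSpectrum (𝓞 K)) (Φ : OrdinaryFiltration τ t v)
    (Φ' : OrdinaryFiltration τ t (cd.σ • v))
    (horth : ∀ a ∈ Φ.fil k, ∀ a' ∈ Φ'.fil k, ebk a (τ k (cd.δ v) a') = 0)
    {x : galoisCohomology ((κ.eisensteinTwist (τ k) hm k).toLocal (Sum.inr v)) 1}
    (hx : x ∈ Φ.ordinaryCore hm k)
    {y : galoisCohomology ((cd.twist (κ.eisensteinTwist (τ k) hm k)).toLocal (Sum.inr v)) 1}
    (hy : y ∈ (Φ'.ordinaryCore hm k).map (cd.transportH1 (κ.eisensteinTwist (τ k) hm k) v)) :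
    (eisensteinDualityDatum hm k cd κ (τ k) ebk hsymmk hequivk hndk hexk hκ).localCup (Sum.inr v) x y = 0 :=
  (eisensteinDualityDatum hm k cd κ (τ k) ebk hsymmk hequivk hndk hexk hκ).localCup_eq_zero_of_mem_strictSubgroup v
    (Φ.twistedFil k) (Φ'.twistedFil k) (Φ.twistedFil_le_comap hm k) (Φ'.twistedFil_le_comap hm k)
    (fun _ hs _ ht ↦ eisensteinDualityDatum_e_span_tmul_eq_zero hm k cd κ (τ k) ebk hsymmk hequivk hndk hexk hκ v
      (Φ.fil k).toAddSubgroup (Φ'.fil k).toAddSubgroup horth hs ht) hx hy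

/-- The same, as the two «`→`» clauses of `DualityDatum.IsSelfOrthogonalAt` for the pair of strict ordinary cores
(`Fbar := (Φ_v̄.ordinaryCore hm k).map transportH1`). [cite: Howard2004HeegnerKolyvagin, H.4 (arXiv p. 7, L78–82) and Lemma 3.1.1] -/
theorem isotropic_ordinaryCore (v : HeightOneSpectrum (𝓞 K)) (Φ : OrdinaryFiltration τ t v)
    (Φ' : OrdinaryFiltration τ t (cd.σ • v))
    (horth : ∀ a ∈ Φ.fil k, ∀ a' ∈ Φ'.fil k, ebk a (τ k (cd.δ v) a') = 0) :
    (∀ x ∈ Φ.ordinaryCore hm k,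
      ∀ y ∈ (Φ'.ordinaryCore hm k).map (cd.transportH1 (κ.eisensteinTwist (τ k) hm k) v),
        (eisensteinDualityDatum hm k cd κ (τ k) ebk hsymmk hequivk hndk hexk hκ).localCup (Sum.inr v) x y = 0) ∧
    (∀ y ∈ (Φ'.ordinaryCore hm k).map (cd.transportH1 (κ.eisensteinTwist (τ k) hm k) v),
      ∀ x ∈ Φ.ordinaryCore hm k,
        (eisensteinDualityDatum hm k cd κ (τ k) ebk hsymmk hequivk hndk hexk hκ).localCup (Sum.inr v) x y = 0) :=
  ⟨fun _ hx _ hy ↦ localCup_ordinaryCore_eq_zero hm k cd κ hκ τ t ebk hsymmk hequivk hndk hexk v Φ Φ' horth hx hy,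
    fun _ hy _ hx ↦ localCup_ordinaryCore_eq_zero hm k cd κ hκ τ t ebk hsymmk hequivk hndk hexk v Φ Φ' horth hx hy⟩

end Cores

end ZpExtension

/-! ## §3 The `E`-level clause for `ẽ = conjPairing e θ log`: place compatibility + isotropy of `Fil` -/

section ConjPairing

variable {K : Type} [Field K] {M : Type} [AddCommGroup M] {n : ℕ}
  (e : M →+ M →+ DiscreteGaloisModule.MuCarrier K n) (θ : M →+ M) (log : DiscreteGaloisModule.MuCarrier K n →+ ZMod n)

/-- **A pairing with `e(a, a) = 0` vanishes on every cyclic subgroup**: `e(c P₀, d P₀) = c d · e(P₀, P₀) = 0` — the Weil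
pairing on the rank-one `Fil_v E[p^k] = Ê[p^k]` (good ordinary `v ∣ p`).
[cite: SilvermanAEC2009, III.8.1 (e_m(T, T) = 1)] [cite: Howard2004HeegnerKolyvagin, Lemma 3.1.1 (Fil_v isotropic)] -/
theorem pairing_eq_zero_of_cyclic {P : Type*} [AddCommGroup P] (e : M →+ M →+ P) (hself : ∀ a : M, e a a = 0)
    (Fil : AddSubgroup M) (hcyc : ∃ P₀ : M, ∀ a ∈ Fil, ∃ c : ℤ, a = c • P₀) :
    ∀ a ∈ Fil, ∀ b ∈ Fil, e a b = 0 := by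
  obtain ⟨P₀, hP₀⟩ := hcyc
  intro a ha b hb
  obtain ⟨c, rfl⟩ := hP₀ a ha
  obtain ⟨d, rfl⟩ := hP₀ b hb
  have h1 : e (c • P₀) P₀ = 0 := by
    rw [← AddMonoidHom.flip_apply e, map_zsmul, AddMonoidHom.flip_apply, hself, zsmul_zero]
  rw [map_zsmul, h1, zsmul_zero]

/-- **The `E`-level clause of §1/§2 for Howard's form `ẽ(a, b) = log e(a, θ b)`**: if `θ ∘ g` (intended
`g = ρ(δ_v)`, so that `θ ∘ g` is the action of the lift `τ_v = τ δ_v` ADAPTED to the place transport `K̄_v̄ ≃ K̄_v`)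
carries `Fil'` (`= Fil_v̄`) into `Fil` (`= Fil_v`), and `e` vanishes on `Fil × Fil`, then `ẽ(a, g a') = 0` for
`a ∈ Fil`, `a' ∈ Fil'`. [cite: Howard2004HeegnerKolyvagin, Rem. 1.3.2 and Lemma 3.1.1 (arXiv p. 7 L81–88, p. 15 L60–62)] -/
theorem conjPairing_eq_zero_of_isotropic (g : M →+ M) (Fil Fil' : AddSubgroup M)
    (hθg : ∀ a' ∈ Fil', θ (g a') ∈ Fil) (hiso : ∀ a ∈ Fil, ∀ b ∈ Fil, e a b = 0) :
    ∀ a ∈ Fil, ∀ a' ∈ Fil', conjPairing e θ log a (g a') = 0 := by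
  intro a ha a' ha'
  rw [conjPairing_apply, hiso a ha _ (hθg a' ha'), map_zero]

/-- Combination: `e(a, a) = 0`, `Fil` cyclic and `θ ∘ g` carrying `Fil'` into `Fil` give the `E`-level clause
`ẽ(a, g a') = 0` consumed by `ZpExtension.localCup_ordinaryCore_eq_zero`.
[cite: Howard2004HeegnerKolyvagin, Lemma 3.1.1] [cite: GreenbergLNM1716, §2 (Ê[p^∞] ≅ ℚ_p/ℤ_p at an ordinary prime)] -/
theorem conjPairing_eq_zero_of_cyclic (hself : ∀ a : M, e a a = 0) (g : M →+ M) (Fil Fil' : AddSubgroup M)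
    (hθg : ∀ a' ∈ Fil', θ (g a') ∈ Fil) (hcyc : ∃ P₀ : M, ∀ a ∈ Fil, ∃ c : ℤ, a = c • P₀) :
    ∀ a ∈ Fil, ∀ a' ∈ Fil', conjPairing e θ log a (g a') = 0 :=
  conjPairing_eq_zero_of_isotropic e θ log g Fil Fil' hθg (pairing_eq_zero_of_cyclic e hself Fil hcyc)

end ConjPairing

end Literature.NumberTheory.EllipticCurves

end
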